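import Summits.NavierStokesRegularity.NavierStokesRegularity.Theorems.HardyPointSinkHardyAncientLimitPressureA
import Literature.Analysis.FluidPDE.LocalTypeILscPressure
import Literature.Analysis.FluidPDE.LocalTypeIProofs
import Literature.Analysis.FluidPDE.PineauVicolOneSliceGradient
import Literature.Analysis.FluidPDE.SereginSverakBlowupLimit
import Literature.Analysis.FluidPDE.ESSLocalHolderBlowupLimit
import Literature.Analysis.FluidPDE.CKN1982Setting
import Literature.Analysis.FunctionSpaces.WeakCompactnessLpFinite
import Literature.Analysis.FunctionSpaces.DiagonalSubsequence
import HarnessLib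

/-!
# Route HardyPointSink — `HardyAncientLimit`, step 8b: a weak `L^{3/2}_{loc}` limit of the
# gauged rescaled pressures

Support file for item stmt-NavierStokesRegularity-9138 (`HardyAncientLimit`) of route
`HardyPointSink` (problem `NavierStokesRegularity`).

For the blow-up sequence of pressures `q_k`, continuous on `{s ≤ 0} × ℝ³` and with
`D(Q(z,r); q_k) ≤ 𝐈₀` for large `k` on every parabolic ball below `s = 0`, the gauged pressures
`q̃_k = q_k - ⨍_{B̄(0,1)} q_k(s ∧ 0, ·)` are bounded in `L^{3/2}(Q(0, m+2))` for every `m`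
(`HardyAncientLimit.lintegral_gauged_rpow_le`). Weak compactness in `L^{3/2}` of each level
(`Literature.Analysis.FunctionSpaces.exists_subseq_tendsto_integral_mul_of_lintegral_rpow_le'`),
Cantor's diagonal argument (`exists_strictMono_forall_of_extraction`), uniqueness of weak limits
(`ae_eq_of_forall_setIntegral_mul_eq`) and gluing along the exhaustion (`exists_glue_of_ae_eq`)
produce one subsequence and one `π ∈ L^{3/2}_{loc}((-∞,0) × ℝ³)` with `q̃_{k_j} ⇀ π` weakly in
`L^{3/2}` of every `Q(0, m+2)` (Albritton–Barker 2019, §3, (3.4)–(3.5); Seregin 2014, App. B.4):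
`HardyAncientLimit.exists_weakLimit_pressure`.

## References

* D. Albritton, T. Barker, arXiv:1811.00502, §3.
* G. Seregin, *Lecture notes on regularity theory for the Navier–Stokes equations* (2014), App. B.
* H. Brezis, *Functional Analysis* (2011), Thm. 3.18.
-/

noncomputable section

open Literature.Analysis.FluidPDE Literature.Analysis.FluidPDE.SereginSverak2009
open Literature.Analysis.FunctionSpaces
open MeasureTheory Set Function Filter Topology Metric TopologicalSpace
open scoped ENNReal NNReal

namespace Summit.NavierStokesRegularity.NavierStokesRegularity.Theorems

namespace HardyAncientLimit

variable {Pq : ℕ → ℝ → EuclideanSpace ℝ (Fin 3) → ℝ} {I₀ : ℝ≥0∞}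

/-- `Q(0, m+2) ⊆ {s ≤ 0} × ℝ³`. [folklore] -/
theorem parabolicCylinder_level_subset (m : ℕ) :
    parabolicCylinder ((m : ℝ) + 2) (0 : ℝ × EuclideanSpace ℝ (Fin 3)) ⊆ Iic 0 ×ˢ univ := by
  intro w hw
  rw [parabolicCylinder_zero_eq] at hw
  exact ⟨hw.1.2.le, mem_univ _⟩

/-- **The level bounds, eventually.** For large `k`, `∫∫_{Q(0,m+2)} |q̃_k|^{3/2}` is bounded by
`2^{1/2} (1 + |B_{m+2}| |B̄₁|⁻¹) (m+2)² 𝐈₀`. [cite: AlbrittonBarker2019, §3 (3.4)] -/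
theorem eventually_lintegral_gauged_le
    (hPc : ∀ᶠ k in atTop, ContinuousOn (uncurry (Pq k)) (Iic 0 ×ˢ univ))
    (hD : ∀ r : ℝ, 0 < r → ∀ z : ℝ × EuclideanSpace ℝ (Fin 3), z.1 ≤ 0 →
      ∀ᶠ k in atTop, cknDOsc r z (Pq k) ≤ I₀) (m : ℕ) :
    ∀ᶠ k in atTop,
      ∫⁻ w in parabolicCylinder ((m : ℝ) + 2) (0 : ℝ × EuclideanSpace ℝ (Fin 3)),
          ‖Pq k w.1 w.2 - ⨍ y in closedBall (0 : EuclideanSpace ℝ (Fin 3)) 1,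
              Pq k (min w.1 0) y‖ₑ ^ (3 / 2 : ℝ) ≤
        2 ^ (1 / 2 : ℝ) * (1 + volume (ball (0 : EuclideanSpace ℝ (Fin 3)) ((m : ℝ) + 2)) *
            (volume (closedBall (0 : EuclideanSpace ℝ (Fin 3)) 1))⁻¹) *
          (ENNReal.ofReal ((m : ℝ) + 2) ^ 2 * I₀) := by
  have hm : (0 : ℝ) < (m : ℝ) + 2 := by positivity
  filter_upwards [hPc, hD ((m : ℝ) + 2) hm 0 le_rfl] with k hk hDk
  refine (lintegral_gauged_rpow_le hk (by linarith [m.cast_nonneg (α := ℝ)])).trans ?_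
  gcongr

/-- The level constant is finite when `𝐈₀` is. [folklore] -/
theorem levelConst_ne_top (hI : I₀ ≠ ⊤) (m : ℕ) :
    2 ^ (1 / 2 : ℝ) * (1 + volume (ball (0 : EuclideanSpace ℝ (Fin 3)) ((m : ℝ) + 2)) *
        (volume (closedBall (0 : EuclideanSpace ℝ (Fin 3)) 1))⁻¹) *
      (ENNReal.ofReal ((m : ℝ) + 2) ^ 2 * I₀) ≠ ⊤ := by
  refine ENNReal.mul_ne_top (ENNReal.mul_ne_top
    (ENNReal.rpow_ne_top_of_nonneg (by norm_num) ENNReal.ofNat_ne_top) ?_)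
    (ENNReal.mul_ne_top (ENNReal.pow_ne_top ENNReal.ofReal_ne_top) hI)
  exact ENNReal.add_ne_top.2 ⟨ENNReal.one_ne_top, ENNReal.mul_ne_top measure_ball_lt_top.ne
    (ENNReal.inv_ne_top.2
      (measure_closedBall_pos volume (0 : EuclideanSpace ℝ (Fin 3)) one_pos).ne')⟩

/-- **A weak `L^{3/2}_{loc}` limit of the gauged pressures along a diagonal subsequence.**
Given a strictly increasing `φ` (the velocity subsequence), pressures `q_k` continuous on
`{s ≤ 0} × ℝ³` for large `k` with `D(Q(z,r); q_k) ≤ 𝐈₀ < ∞` for large `k` on every parabolic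
ball below `s = 0`, there are a strictly increasing `χ` and `π` with, for every level `m`,
`π ∈ L^{3/2}(Q(0,m+2))` and `q̃_{φ(χ(j))} ⇀ π` weakly in `L^{3/2}(Q(0,m+2))` (tested against
`L³`). [cite: AlbrittonBarker2019, §3 (3.4)–(3.5)] -/
theorem exists_weakLimit_pressure {φ : ℕ → ℕ} (hφ : StrictMono φ)
    (hPc : ∀ᶠ k in atTop, ContinuousOn (uncurry (Pq k)) (Iic 0 ×ˢ univ))
    (hD : ∀ r : ℝ, 0 < r → ∀ z : ℝ × EuclideanSpace ℝ (Fin 3), z.1 ≤ 0 →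
      ∀ᶠ k in atTop, cknDOsc r z (Pq k) ≤ I₀)
    (hI : I₀ ≠ ⊤) :
    ∃ (χ : ℕ → ℕ) (π : ℝ → EuclideanSpace ℝ (Fin 3) → ℝ), StrictMono χ ∧
      ∀ m : ℕ, MemLp (uncurry π) (3 / 2)
          (volume.restrict (parabolicCylinder ((m : ℝ) + 2) (0 : ℝ × EuclideanSpace ℝ (Fin 3)))) ∧
        ∀ g : ℝ × EuclideanSpace ℝ (Fin 3) → ℝ,
          MemLp g 3 (volume.restrict (parabolicCylinder ((m : ℝ) + 2)
            (0 : ℝ × EuclideanSpace ℝ (Fin 3)))) →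
          Tendsto (fun j => ∫ w in parabolicCylinder ((m : ℝ) + 2) (0 : ℝ × EuclideanSpace ℝ (Fin 3)),
              (Pq (φ (χ j)) w.1 w.2 - ⨍ y in closedBall (0 : EuclideanSpace ℝ (Fin 3)) 1,
                Pq (φ (χ j)) (min w.1 0) y) * g w) atTop
            (𝓝 (∫ w in parabolicCylinder ((m : ℝ) + 2) (0 : ℝ × EuclideanSpace ℝ (Fin 3)),
              π w.1 w.2 * g w)) := by
  classical
  set pg : ℕ → ℝ × EuclideanSpace ℝ (Fin 3) → ℝ := fun k w =>
    Pq k w.1 w.2 - ⨍ y in closedBall (0 : EuclideanSpace ℝ (Fin 3)) 1, Pq k (min w.1 0) y with hpg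
  set Q : ℕ → Set (ℝ × EuclideanSpace ℝ (Fin 3)) := fun m =>
    parabolicCylinder ((m : ℝ) + 2) (0 : ℝ × EuclideanSpace ℝ (Fin 3)) with hQ
  set B : ℕ → ℝ≥0∞ := fun m =>
    2 ^ (1 / 2 : ℝ) * (1 + volume (ball (0 : EuclideanSpace ℝ (Fin 3)) ((m : ℝ) + 2)) *
        (volume (closedBall (0 : EuclideanSpace ℝ (Fin 3)) 1))⁻¹) *
      (ENNReal.ofReal ((m : ℝ) + 2) ^ 2 * I₀) with hB
  have hQm : ∀ m, MeasurableSet (Q m) := fun m => (isOpen_parabolicCylinder _ _).measurableSet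
  have hfin : ∀ m, IsFiniteMeasure (volume.restrict (Q m)) := fun m =>
    isFiniteMeasure_restrict_parabolicCylinder _ _
  -- eventual measurability and level bounds of the gauged pressures
  have hmeas : ∀ m, ∀ᶠ k in atTop, AEStronglyMeasurable (pg k) (volume.restrict (Q m)) := by
    intro m
    filter_upwards [hPc] with k hk
    exact ((continuousOn_gauged hk).mono (parabolicCylinder_level_subset m)).aestronglyMeasurable
      (hQm m)
  have hbd : ∀ m, ∀ᶠ k in atTop, ∫⁻ w in Q m, ‖pg k w‖ₑ ^ (3 / 2 : ℝ) ≤ B m := fun m =>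
    eventually_lintegral_gauged_le hPc hD m
  -- the property of subsequences: weak convergence on the level `m`
  let P : ℕ → (ℕ → ℕ) → Prop := fun m χ => ∃ πm : ℝ → EuclideanSpace ℝ (Fin 3) → ℝ,
    MemLp (uncurry πm) (3 / 2) (volume.restrict (Q m)) ∧
      ∀ g : ℝ × EuclideanSpace ℝ (Fin 3) → ℝ, MemLp g 3 (volume.restrict (Q m)) →
        Tendsto (fun j => ∫ w in Q m, pg (φ (χ j)) w * g w) atTop
          (𝓝 (∫ w in Q m, πm w.1 w.2 * g w))
  have hsub : ∀ n (χ χ' : ℕ → ℕ), (∃ ρ : ℕ → ℕ, StrictMono ρ ∧ ∀ᶠ k in atTop, χ' k = χ (ρ k)) →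
      P n χ → P n χ' := by
    rintro n χ χ' ⟨ρ, hρ, hρe⟩ ⟨πm, hπm, hconv⟩
    refine ⟨πm, hπm, fun g hg => ?_⟩
    refine ((hconv g hg).comp hρ.tendsto_atTop).congr' ?_
    filter_upwards [hρe] with k hk
    simp only [Function.comp_apply, hk]
  have hex : ∀ n (χ : ℕ → ℕ), StrictMono χ → ∃ ψ : ℕ → ℕ, StrictMono ψ ∧ P n (χ ∘ ψ) := by
    intro n χ hχ
    have hev : ∀ᶠ j in atTop, AEStronglyMeasurable (pg (φ (χ j))) (volume.restrict (Q n)) ∧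
        ∫⁻ w in Q n, ‖pg (φ (χ j)) w‖ₑ ^ (3 / 2 : ℝ) ≤ B n :=
      (hφ.comp hχ).tendsto_atTop.eventually ((hmeas n).and (hbd n))
    obtain ⟨j₀, hj₀⟩ := eventually_atTop.1 hev
    have hpq : (3 / 2 : ℝ).HolderConjugate 3 := Real.holderConjugate_iff.2 ⟨by norm_num, by norm_num⟩
    haveI := hfin n
    obtain ⟨σ, hσ, g, hg, -, hw⟩ := exists_subseq_tendsto_integral_mul_of_lintegral_rpow_le'
      (μ := volume.restrict (Q n)) hpq (f := fun j => pg (φ (χ (j + j₀))))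
      (fun j => (hj₀ _ (Nat.le_add_left _ _)).1) (levelConst_ne_top hI n)
      (fun j => (hj₀ _ (Nat.le_add_left _ _)).2)
    have h32 : ENNReal.ofReal (3 / 2 : ℝ) = 3 / 2 := by
      rw [ENNReal.ofReal_div_of_pos (by norm_num : (0 : ℝ) < 2), ENNReal.ofReal_ofNat,
        ENNReal.ofReal_ofNat]
    have h3 : ENNReal.ofReal (3 : ℝ) = 3 := ENNReal.ofReal_ofNat 3
    refine ⟨fun j => σ j + j₀, fun a b hab => Nat.add_lt_add_right (hσ hab) _,
      Function.curry g, ?_, fun ψ hψ => ?_⟩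
    · rw [Function.uncurry_curry, ← h32]
      exact hg
    · rw [h3] at hw
      have := hw ψ hψ
      simpa only [Function.comp_apply, Function.curry_apply] using this
  obtain ⟨χ, hχ, hPχ⟩ := exists_strictMono_forall_of_extraction hsub hex
  choose πl hπl hconv using hPχ
  -- consistency of the level limits
  have hcons : ∀ n m, n ≤ m → ∀ᵐ w ∂(volume.restrict (Q n)),
      (fun w : ℝ × EuclideanSpace ℝ (Fin 3) => πl n w.1 w.2) w = (fun w => πl m w.1 w.2) w := by
    intro n m hnm
    have hQnm : Q n ⊆ Q m :=
      parabolicCylinder_mono (by positivity) (by exact_mod_cast Nat.add_le_add_right hnm 2) 0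
    have hπm' : MemLp (uncurry (πl m)) (3 / 2) (volume.restrict (Q n)) :=
      (hπl m).mono_measure (Measure.restrict_mono hQnm le_rfl)
    have key := ae_eq_of_forall_setIntegral_mul_eq (hπl n) hπm' fun g hg =>
      tendsto_nhds_unique (hconv n g hg)
        (SuitableCompactness.tendsto_setIntegral_mul_of_subset (hQm n) hQnm
          (f := fun j w => pg (φ (χ j)) w) (g := fun w => πl m w.1 w.2) (hconv m) g hg)
    filter_upwards [key] with w hw
    exact hw
  -- glue along the exhaustion
  let N : ℝ × EuclideanSpace ℝ (Fin 3) → ℕ := fun w => if h : ∃ m, w ∈ Q m then Nat.find h else 0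
  have hNS : ∀ w ∈ ⋃ m, Q m, w ∈ Q (N w) := by
    intro w hw
    obtain ⟨m, hm⟩ := mem_iUnion.1 hw
    have h : ∃ m, w ∈ Q m := ⟨m, hm⟩
    simp only [N, dif_pos h]
    exact Nat.find_spec h
  have hNle : ∀ m, ∀ w ∈ Q m, N w ≤ m := by
    intro m w hw
    have h : ∃ m, w ∈ Q m := ⟨m, hw⟩
    simp only [N, dif_pos h]
    exact Nat.find_min' h hw
  obtain ⟨Pglue, hPglue, -⟩ := exists_glue_of_ae_eq (μ := volume) hQm N hNS hNle
    (fun m (w : ℝ × EuclideanSpace ℝ (Fin 3)) => πl m w.1 w.2) hcons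
  refine ⟨χ, fun t x => Pglue (t, x), hχ, fun m => ⟨?_, fun g hg => ?_⟩⟩
  · refine (hπl m).ae_eq ?_
    filter_upwards [hPglue m] with w hw
    exact hw.symm
  · have e : ∫ w in Q m, Pglue (w.1, w.2) * g w = ∫ w in Q m, πl m w.1 w.2 * g w := by
      refine integral_congr_ae ?_
      filter_upwards [hPglue m] with w hw
      rw [hw]
    rw [e]
    exact hconv m g hg

end HardyAncientLimit

end Summit.NavierStokesRegularity.NavierStokesRegularity.Theorems

end
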